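import Mathlib
import HarnessLib
import HarnessLib.Audit
import Summits.CriticalPhenomena.Statement

/-!
Route: PercRayRenewal

# Route PercRayRenewal — ray renewal through the BGN-shattered cluster — two-arms ratio exponent c₂
> 1 plus any power-law line-avoidance decay in the jump world

It suffices to show X = T2 ∧ G (card
CriticalPhenomena/PercolationContinuityZ3/ray-piece-change-renewal, variant B, with the
gap threshold lowered from s > (c₂+1)/(c₂−1) to ANY power law by blocking the ray at scale R^{1−η}).
T2 (TwoArmsRatioExponent, unconditional, at p_c(ℤ³)): there are c₂ > 1 and C with
P_{p_c}(A₂(r,n)) ≤ C (r/n)^{c₂} for all 1 ≤ r ≤ n, where A₂(r,n) = "inside Λ(n) = [−n,n]³ there are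
two DISTINCT open clusters
both meeting Λ(r) and ∂Λ(n)" (the event of van den Berg–van Engelenburg, arXiv:2009.13337, Prop. 2).
G (JumpLineAvoidanceDecay, jump world): if θ(p_c) > 0 then for some κ > 0, C: P_{p_c}(none of e₀,
2e₀, …, m e₀ lies in an
infinite cluster) ≤ C m^{−κ} for all m ≥ 1.
Lean: `(∃ c C : ℝ, 1 < c ∧ ∀ r n : ℕ, 1 ≤ r → r ≤ n →
(Literature.Probability.Percolation.bondPercolation (Literature.Probability.LatticeModels.zdGraph 3)
(Literature.Probability.Percolation.criticalProbI 3)).real {ω | ∃ u ∈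
Literature.Probability.LatticeModels.box 3 r, ∃ v ∈ Literature.Probability.LatticeModels.box 3 r, (∃
y ∈ Literature.Probability.LatticeModels.innerBoundary (Literature.Probability.LatticeModels.zdGraph
3) (Literature.Probability.LatticeModels.box 3 n), ω ∈ Literature.Probability.Percolation.openConnIn
↑(Literature.Probability.LatticeModels.box 3 n) u y) ∧ (∃ y ∈
Literature.Probability.LatticeModels.innerBoundary (Literature.Probability.LatticeModels.zdGraph 3)
(Literature.Probability.LatticeModels.box 3 n), ω ∈ Literature.Probability.Percolation.openConnIn
↑(Literature.Probability.LatticeModels.box 3 n) v y) ∧ ω ∉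
Literature.Probability.Percolation.openConnIn ↑(Literature.Probability.LatticeModels.box 3 n) u v} ≤
C * ((r : ℝ) / n) ^ c) ∧ (0 < Literature.Probability.Percolation.theta
(Literature.Probability.LatticeModels.zdGraph 3) 0 (Literature.Probability.Percolation.criticalProbI
3) → ∃ κ C : ℝ, 0 < κ ∧ ∀ m : ℕ, 1 ≤ m → (Literature.Probability.Percolation.bondPercolation
(Literature.Probability.LatticeModels.zdGraph 3) (Literature.Probability.Percolation.criticalProbI
3)).real {ω | ∀ i : ℕ, 1 ≤ i → i ≤ m → ω ∉ Literature.Probability.Percolation.percolatesAt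
(Pi.single 0 (i : ℤ) : Literature.Probability.LatticeModels.Site 3)} ≤ C * (m : ℝ) ^ (-κ))`

## Assembly
The Assembly IS the ray-renewal criterion (a conditional theorem, ≈ 2 pages on paper; Lean
difficulty L): suppose θ(p_c) ≠ 0, so
θ(p_c) = θ* > 0 (measureReal_nonneg). (1) R := {t ∈ ℤ : |C(t e₀)| = ∞} is a.s. non-empty and
unbounded above: {R = ∅} and
{R bounded above} are e₀-shift invariant, P(0 ∈ R) = θ* > 0, and P(max R = t) does not depend on t,
hence vanishes
(ergodic_relabel_shift_bondPercolation; no Birkhoff needed). (2) By HalfSpacePiecesFinite every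
H-piece W_t (t ∈ R, t ≥ 0) is finite,
so consecutive points of R ∩ ℕ lie in different H-pieces infinitely often ("changes"). (3) At scale
k (depths t ∈ [2^k, 2^{k+1}),
r_k = 2^{⌊k(1−η)⌋}, block points x_j = (2^k + j r_k) e₀): a change with gap ≤ r_k puts both points
in Λ(2r_k)+x_j, both joined to
∂(Λ(2^{k−1})+x_j) inside that box (infinite clusters exit finite boxes) and not joined to each other
inside it (the box lies in H
and the H-pieces differ) — the translate of A₂(2r_k, 2^{k−1}); a change with gap > r_k gives t ∈ R
with the next r_k axis sites
outside R. (4) Union bounds + translation invariance: P(change at scale k) ≤ (2^k/r_k + 2) C (4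
r_k/2^k)^{c₂} + 2^k · 4 e_{⌊r_k/2⌋}/r_k
with e_m the probability in G (using m·P(0 ∈ R, next 2m−1 sites ∉ R) ≤ e_m: the events {j ∈ R,
j+1..2m ∉ R}, j = 1..m, are
disjoint and lie in {m+1..2m ∉ R}); with T2 and G (η < κ/(1+κ)) this is summable in k. (5)
Borel–Cantelli (measure_limsup_eq_zero):
a.s. finitely many scales carry a change, each scale carries ≤ 2^k changes — contradiction with (2).
Hence θ(p_c) = 0.

Rationale: WHY THIS LINE. Assume θ(p_c) = θ* > 0 and walk along the ray ρ = {t e₀ : t ≥ 0} inside the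
half-space H = {x₀ ≥ 0}: Barsky–Grimmett–Newman
(θ_H(p_c) = 0, PROVED in tree as
Literature.Probability.Percolation.BarskyGrimmettNewman1991_Z3_holds; Grimmett1999 Thm (7.35)) plus
finite energy makes the H-piece of every ray point finite, while stationarity + ergodicity of the
e₀-shift
(Literature.Probability.Percolation.ergodic_relabel_shift_bondPercolation) puts infinitely many ray
points in infinite clusters, so
consecutive such points change H-piece infinitely often; a change with gap g at depth t ∈ [R, 2R)
forces, in the bulk box Λ(R/2)
around the nearest block point of spacing r = R^{1−η}, two distinct boundary-reaching clusters
within distance 2r (the translate of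
A₂(2r, R/2)) when g ≤ r, and a vacant axis segment of length r when g > r. Counting (new
bookkeeping, checked in NOTES.md):
P(short-gap change at scale R) ≤ (R/r + 2)·π₂(2r, R/2) ≤ C (r/R)^{c₂−1} = C R^{−η(c₂−1)}, and
P(long-gap change at scale R) ≤
R·P(0 ∈ C_∞, gap > r) ≤ R·e_{r/2}/(r/2) ≤ 4 R^{η} e_{R^{1−η}/2} (m·P(0 ∈ C_∞, gap ≥ 2m) ≤ e_m by a
disjoint-events/stationarity
trick, no Palm calculus), so T2 ∧ G make both summable over dyadic R once η < κ/(1+κ), and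
Borel–Cantelli contradicts "infinitely
many changes": T2 → G → θ(p_c) = 0. Sources: KozmaNitzan2024 (arXiv:2401.12397) p.2 items 4–5 (the
two folklore criteria — E|x| < ∞
via BGN, "two-arms exponent too large" — recorded without proofs or thresholds), Cerf2015
(arXiv:1306.3105) Thm 1.1–1.2 and
VandenbergVanengelenburg2022 Thm 1 / Prop 2 (the only rigorous two-arms bounds: exponent ∈ [12/23,
19] in d = 3),
DuminilcopinKozmaTassion2020, Grimmett1999 §7.3/§8.4. Imported from another area: renewal/ergodic
bookkeeping of a stationary point
process on ℤ (Kac-type disjointness) — the 1-dimensionality of the ray is what turns the hopeless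
bulk union bound R³·R^{−c₂} into
R^{η}·(r/R)^{c₂}, so that the threshold is c₂ > 1 (heuristically c₂ = d − 1/ν ≈ 1.86) instead of c₂
> 3. What it does that prior
routes do not: PercLowPointHalfSpace needs a BOUNDARY two-arm exponent a₂ > 5/2 at adjacent roots
plus a mass bound; PercAnnulusCrossing
needs crossing probabilities < 1; here sure crossings and unboundedly many spanning clusters away
from the ray are tolerated, the
jump-world input is the weakest on file (any power κ > 0; implied by PercTruncatedSusceptibility's
L/r4 and PercDebrisSweep's K), and
the negatives index (one SAW item) is not touched.

RANKED CRUXES. #2 TwoArmsRatioExponent (crux) — T2 — at p_c(ℤ³) the two-arms RATIO exponent exceeds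
one: ∃ c₂ > 1, C with P_{p_c}(A₂(r,n)) ≤ C (r/n)^{c₂} for all 1 ≤ r ≤ n, A₂(r,n) = two distinct open
clusters of the configuration restricted to Λ(n), both meeting Λ(r) and the inner vertex boundary of
Λ(n) (card item T2; vdB–vE's A₂(m,n)). [difficulty: open-problem] (why it might fail: Rigorously
only exponent ≥ 12/23 at r = 1 (Cerf Thm 1.1, site) and A₂(Λ(n), n^43) → 0 (Thm 1.2); BK-type
counting caps at 2β/ν ≈ 0.95 < 1, so c₂ > 1 needs distinct-cluster repulsion (heuristic d − 1/ν ≈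
1.86, unproved); the ratio law is false for d > 6.) [Cerf2015, VandenbergVanengelenburg2022,
DuminilcopinKozmaTassion2020, KozmaNitzan2024, KozmaNachmias2011, arXiv:1302.0421,
Literature.Barriers.CriticalPhenomena.SpanningClustersAboveSix]
#3 JumpLineAvoidanceDecay (crux) — G — in the jump world the axis is visited with a power-law rate:
θ(p_c) > 0 ⇒ ∃ κ > 0, C: P_{p_c}(∀ 1 ≤ i ≤ m, |C(i e₀)| < ∞) ≤ C m^{−κ} for all m ≥ 1 (card item
G1/G1e in its weakest useful form: ANY κ > 0 suffices for the renewal count; e_m → 0 itself is free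
by ergodicity). [difficulty: XL] (why it might fail: Same-p statement about the counterfactual
percolating p_c: finite clusters / vacant segments beside a dense infinite cluster are controlled
only by sprinkling (Grimmett–Marstrand, p > p_c); 1/r² chains percolate at p_c with power-law
truncated functions, so finite range must enter.) [KozmaNitzan2024, Grimmett1999,
BarskyGrimmettNewman1991, doi:10.1007/bf01218582,
Literature.Barriers.CriticalPhenomena.LongRangeDiscontinuity,
Literature.Barriers.CriticalPhenomena.SprinklingRenormalisation]
#4 JumpTruncatedOneArmDecay (crux) — G1′ — in the jump world finite clusters have a power-law radius
tail: θ(p_c) > 0 ⇒ ∃ a > 0, C: P_{p_c}(0 ↔ ∂Λ(n) in Λ(n), |C(0)| < ∞) ≤ C n^{−a} for all n ≥ 1 (card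
item G1′ with the demand lowered from a > 4 to any a > 0; the p > p_c analogue is Grimmett1999 Thm
(8.21), σ(p) > 0, with exponential decay). Implies JumpLineAvoidanceDecay by the box chain (support
BoxChainLineAvoidance); implied by PercTruncatedSusceptibility.FiniteRadiusExpDecayOfTheta and by
its L (χ^f < ∞ gives a = 1). [difficulty: XL] (why it might fail: Known only for p > p_c through
slab technology (Grimmett1999 Thm 8.18/8.21 via Thm 7.2, η > 0 'vital' p.162); at a percolating p_c
nothing excludes fat finite clusters with radius tail slower than any power; no same-p block
construction from θ(p) > 0 alone exists (Cerf2015 p.4).) [Grimmett1999, Cerf2015,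
doi:10.1214/aop/1176991976, doi:10.1007/bf01218582,
Literature.Barriers.CriticalPhenomena.SprinklingRenormalisation]
#9 BoxChainLineAvoidance (support) — JumpTruncatedOneArmDecay → JumpLineAvoidanceDecay. Proof
(provable now, ≈ 1 page): place K = ⌊m/(2n+2)⌋ disjoint boxes Λ(n)+x_j centred at axis sites x_j ∈
{e₀,…,m e₀}; x_j ∉ C_∞ ⇒ C(x_j) finite ⇒ either the truncated one-arm event of radius n at x_j
(probability π^f_n each, union bound K π^f_n) or x_j ↮ ∂(Λ(n)+x_j) inside its box — events
determined by disjoint edge sets, hence independent (bondPercolation_inter_of_disjoint), each of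
probability 1 − P(0 ↔ ∂Λ(n)) ≤ 1 − θ(p_c); so e_m ≤ K C n^{−a} + (1 − θ*)^K, and n = m^λ with λ ∈
(1/(1+a), 1) gives e_m ≤ C′ m^{−(λ(1+a)−1)}. [difficulty: provable-now] [Grimmett1999,
Literature.Probability.Percolation.bondPercolation_inter_of_disjoint]
#9 HalfSpacePiecesFinite (support) — BGN at every depth, bulk form: for every t ≥ 0, P_{p_c}-a.s.
the set of sites joined to t e₀ by open paths staying in H = {x₀ ≥ 0} is finite. Proof (provable
now): for t = 0 this is BarskyGrimmettNewman1991_Z3_holds transported through the restriction-to-H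
coupling (HalfSpaceBGN.lean); for t > 0 force open the t axis edges from 0 to t e₀ (finite energy,
bondPercolation_finiteEnergy / harris_fkg_holds, p_c > 0): P(piece of t e₀ infinite) ≤ p_c^{−t}
P(piece of 0 infinite) = 0. [difficulty: provable-now] [BarskyGrimmettNewman1991, Grimmett1999,
Literature.Probability.Percolation.BarskyGrimmettNewman1991_Z3_holds]

TWO-LAYER PLAN. Foreseen glued splits (none filed now). Assembly ⇐ InfinitelyManyPieceChanges (steps
1–2: ergodicity + HalfSpacePiecesFinite) →
RenewalCount (steps 3–5: T2 → G → a.s. finitely many changes) → Assembly. TwoArmsRatioExponent ⇐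
PointwiseTwoArms (∃ β > 1, α:
π₂(r,n) ≤ C r^α n^{−β}) → QuasiMultiplicativity (ratio form) → T2; if only the pointwise bound
lands, RESTATE the pair instead:
the count closes whenever β > 1 and G holds with κ > max(0, (α−β)/(β−1)) (take r = R^λ, λ <
(β−1)/(α−1)) — recorded in NOTES.md.
JumpLineAvoidanceDecay ⇐ JumpTruncatedOneArmDecay (filed, glue BoxChainLineAvoidance) or ⇐
PercTruncatedSusceptibility.L / PercDebrisSweep.K.

KILL CRITERIA. (i) A Monte Carlo fit c₂ ≤ 1 for P_{p_c}(A₂(r,n)) (r = 2..16, n = 16..128, p_c =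
0.2488118) kills T2 as stated → pivot to the
pointwise/stronger-G trade-off of the two-layer plan if β > 1 survives, else `close --reason
refuted:TwoArmsRatioExponent`.
(ii) A rigorous or numerical demonstration that π₂(R^{1−η}, R) ≫ R^{−η} for small η (near-diagonal
proliferation of touching
spanning clusters in d = 3, Aizenman-style) refutes the ratio law → close. (iii) van Engelenburg's
MSc thesis §4.3 (KozmaNitzan2024
ref. [8]; acq-01757 pending) deriving θ(p_c) = 0 from a PURE two-arms hypothesis at threshold ≤ 1.86
would dominate this route →
`close --reason superseded`. (iv) G and G1′ cannot be refuted short of proving θ(p_c) > 0; a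
jump-world self-consistent picture with
sub-power line-avoidance decay (fat finite clusters beside C_∞) downgrades them to 'no tool' and the
route goes dormant.
(v) θ(p_c) = 0 proved elsewhere moots everything.

NOT DECOMPOSED YET. Palm/Kac formalism (deliberately avoided: only stationarity and the
disjoint-events trick are used); the engine for T2 (AKN/Cerf
√|𝒞| counting sharpened by cluster repulsion, or a hyperscaling input 'boundedly many spanning
clusters meet a mesoscopic box');
the engine for G/G1′ (same-p coarse graining; uniqueness-based 'a large finite cluster must be
sealed from the dense C_∞ by a closed
cutset of size ≥ n' counting); variant A of the card (the unpublished les Diablerets lemma 'E|x| < ∞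
⇒ θ(p_c) = 0', which would
replace T2 by nothing and G by κ > 1) — not filed until a proof sketch exists; site percolation and
other lattice directions.

CHEAPEST FALSIFIER. Monte Carlo of the two-arms ratio law at p_c^bond(ℤ³) = 0.24881182 (Wang et al.
2013): sample configurations in Λ(n), n ∈ {16, 32,
64, 128}, count runs with two distinct clusters joining Λ(r) to ∂Λ(n) for r ∈ {2, 4, 8, 16}, fit log
P against log(r/n); a slope
≤ 1 kills T2 (expected ≈ 1.86 = d − 1/ν; BK-independent arms would give 0.95, so the fit genuinely
discriminates). ~10 cpu-hours
with union–find (kit); not run in this planner seat. Lookup leg: a printed numerical value of the 3D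
'two touching distinct critical
clusters' (closed-pivotal / thermal) exponent below 1 would equally kill it — none found in the
searches below.

NUMBERS. Rigorous: P_{p_c}(two-arms(0,n)) ≤ c n^{−γ} for all γ < 12/23 in d = 3 (Cerf2015 Thm 1.1,
site percolation; AKN/GGR give 1/2 in all d);
A₂(Λ(n), n^43) → 0 (Cerf2015 Thm 1.2, d = 3); P(two-arms(0,n)) ≥ c n^{−(d²+4d−2)} = c n^{−19} and
P(A₂(n_i, M n_i)) ≥ δ along scales
(VandenbergVanengelenburg2022 Thm 1, Prop 2); high-d exponent 4 (KozmaNachmias2011). Numerical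
(arXiv:1302.0421 p.2): p_c^bond =
0.24881182(10), 1/ν = 1.1410(15), β/ν = 0.47705(15); hence heuristic c₂ = d − 1/ν ≈ 1.859 (2D check:
2 − 3/4 = 5/4 = the alternating
4-arm exponent; d = 6: 4), BK heuristic 2β/ν ≈ 0.954. Thresholds of this route: c₂ > 1 (T2); κ > 0
(G); a > 0 (G1′); η < κ/(1+κ)
in the count. Card thresholds superseded: s > (c₂+1)/(c₂−1), a > s + 2. Items at open: 6 (3 cruxes,
2 support, 1 assembly).

DEFINITION REQUESTS. None required: A₂(r,n), line avoidance and the truncated one-arm event are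
written inline over box / innerBoundary / openConnIn /
percolatesAt / siteToBoundary (all in Literature.Probability.Percolation / LatticeModels). Optional
later: a named
`twoArmsBox d r n : Set (BondConfig (Site d))` if a second route wants A₂.

Novelty: Searches (2026-08-15): `lit search --hybrid "two-arms exponent critical percolation three dimensions
distinct clusters theta(p_c)"`
(15 textbook hits, none specific); `lit search --source zbmath "two-arms percolation"` (4: Cerf2015
= doi:10.1214/14-aop940,
VandenbergVanengelenburg2022 = doi:10.1214/21-aihp1153, two unrelated); `lit search --source zbmath
"infinite cluster intersection line
half-space critical percolation nearest point"` (0); `lit vsearch "<les Diablerets E|x| criterion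
paraphrase>"` (textbooks only);
`lit frontier CriticalPhenomena --since 2020` (30 rows, none on two-arms or ray criteria); `lit
galaxy search "two-arms exponent" --star
all` and `--star pdf` (saturated > 90 s twice), then `lit galaxy search "two arms exponent
percolation" --star all` (pdf leg 0 hits,
crabby leg 0 hits, panama leg saturated; the card's audit ran the galaxy query 'two-arms exponent'
on 2026-08-15 with no hit); arXiv / OpenAlex / S2 legs rate-limited (HTTP 429). Read:
arXiv:2401.12397 p.2 (items 4–5 verbatim, refs [7] = Cerf2015, [8] =
van Engelenburg MSc 2020), arXiv:1306.3105 p.3 (Thms 1.1–1.3), arXiv:2009.13337 p.2 (Thm 1, Prop 2,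
definition of A₂(m,n)),
arXiv:1302.0421 p.2 (exponents), Grimmett1999 PDF p.218 (Thms 8.18, 8.21).
Nearest prior art found: KozmaNitzan2024 (arXiv:2401.12397) p.2 item 4 (les Diablerets 2012: E|x| <
∞ for the nearest axis point of
the infinite cluster ⇒ θ(p_c) = 0, 'simple corollary of BGN, never published') and item 5 ('if the
two arms exponent is to  [refs: 10.1214/14-aop940, 10.1214/21-aihp1153, 2401.12397, 1306.3105, 2009.13337, 1302.0421, doi:10.1214/14-aop940, doi:10.1214/21-aihp1153, Cerf2015, VandenbergVanengelenburg2022, Grimmett1999, KozmaNitzan2024]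

Barriers (technique_class: ray-renewal, two-arms-ratio, halfspace-shattering): - technique_class: ray-renewal, two-arms-ratio, halfspace-shattering
- Literature.Barriers.CriticalPhenomena.SpanningClustersAboveSix: consistent and USED — for d > 6
the ratio law T2 is false (≳ r^{d−4}R^{−2} spanning clusters meet Λ(r), so π₂(R^{1−η}, R) → 1) while
θ(p_c) = 0 holds; T2 is exactly a d < 6 (hyperscaling: boundedly many spanning clusters per
mesoscopic box) input, as the barrier demands of any correct d = 3 mechanism; nothing here needs
crossing probabilities < 1.
- Literature.Barriers.CriticalPhenomena.TransverseCrossingsNeedNotMeet: evaded — no gluing of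
crossings; the only geometry used is 'an infinite path from a point of H whose H-piece is finite
must cross the wall' and 'Λ(R/2)+x ⊂ H for x at depth ≥ R', valid in every dimension.
- Literature.Barriers.CriticalPhenomena.SprinklingRenormalisation: evaded in form — everything
happens at p = p_c, no parameter change, no block renormalisation; its substance (no same-p control
of finite clusters beside C_∞) reappears honestly inside G/G1′, which is why they are cruxes.
- Literature.Barriers.CriticalPhenomena.SlabLimitUniformControl: not engaged — no slabs, no k → ∞
limit; BGN is used at p_c(ℤ³) as proved.
- Literature.Barriers.CriticalPhenomena.LongRangeDiscontinuity: applies as calibration — 1-d 1/r²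
models jump at p_c; there BGN-type half-line shattering and finite-range box independence along a
ray are unavailable and truncated functions decay only polynomially, so any proof of G/G1′ must use
finite range a

sub-problem: PercolationContinuityZ3 · status: draft · opened planner-plancard-CriticalPhenomena-Percolatio-8d59ba0b-0 2026-08-15T11:34:41Z · rev 4 · ledger route-CriticalPhenomena-PercRayRenewal
GENERATED by the gate from the ledger (D-0016/17). Provers cite these decls: `theorem foo : Summit.CriticalPhenomena.PercolationContinuityZ3.Theses.PercRayRenewal.<Decl> := …` in Summits/CriticalPhenomena/PercolationContinuityZ3/Theorems/<Name>.lean.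
-/

namespace Summit.CriticalPhenomena.PercolationContinuityZ3.Theses.PercRayRenewal

open scoped BigOperators Topology Manifold Classical MeasureTheory ProbabilityTheory Matrix InnerProductSpace ComplexConjugate ContinuousMap
open Filter Set Function TopologicalSpace MeasureTheory

attribute [summit_statement] _root_.PercolationContinuityZ3

/-- item stmt-CriticalPhenomena-4625 · crux · rank 2 · open · by planner
why it might fail: Open in d=3: rigorously 12/23 ≤ exponent ≤ 19 (Cerf2015 Thm 1.1, site; vdB–vE Thm 1, Prop 2: non-explicit δ(M) floor); BK counting certifies ≤ 2β/ν ≈ 0.95 < 1, so c > 1 needs unproved cluster repulsion (heuristic d − 1/ν ≈ 1.86) + r-uniform quasi-multiplicativity of a non-monotone event; false, d>6.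
sources: Cerf2015, VandenbergVanengelenburg2022, AizenmanKestenNewman1987, DuminilcopinIoffeVelenik2016, Coniglio1982, KozmaNitzan2024
[crux] T2 — at p_c(ℤ³) the two-arms RATIO exponent exceeds one: ∃ c₂ > 1, C with P_{p_c}(A₂(r,n)) ≤
C (r/n)^{c₂} for all 1 ≤ r ≤ n, A₂(r,n) = two distinct open clusters of the configuration restricted
to Λ(n), both meeting Λ(r) and the inner vertex boundary of Λ(n) (card item T2; vdB–vE's A₂(m,n)).
[difficulty: open-problem] -/
@[route_item "route-CriticalPhenomena-PercRayRenewal"]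
def TwoArmsRatioExponent : Prop :=
  ∃ c C : ℝ, 1 < c ∧ ∀ r n : ℕ, 1 ≤ r → r ≤ n → (Literature.Probability.Percolation.bondPercolation (Literature.Probability.LatticeModels.zdGraph 3) (Literature.Probability.Percolation.criticalProbI 3)).real {ω | ∃ u ∈ Literature.Probability.LatticeModels.box 3 r, ∃ v ∈ Literature.Probability.LatticeModels.box 3 r, (∃ y ∈ Literature.Probability.LatticeModels.innerBoundary (Literature.Probability.LatticeModels.zdGraph 3) (Literature.Probability.LatticeModels.box 3 n), ω ∈ Literature.Probability.Percolation.openConnIn ↑(Literature.Probability.LatticeModels.box 3 n) u y) ∧ (∃ y ∈ Literature.Probability.LatticeModels.innerBoundary (Literature.Probability.LatticeModels.zdGraph 3) (Literature.Probability.LatticeModels.box 3 n), ω ∈ Literature.Probability.Percolation.openConnIn ↑(Literature.Probability.LatticeModels.box 3 n) v y) ∧ ω ∉ Literature.Probability.Percolation.openConnIn ↑(Literature.Probability.LatticeModels.box 3 n) u v} ≤ C * ((r : ℝ) / n) ^ c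

/-- item stmt-CriticalPhenomena-4626 · crux · rank 3 · closed · proved by Summit.CriticalPhenomena.PercolationContinuityZ3.Theorems.PercRayRenewalJumpLineAvoidanceDecay.jumpLineAvoidanceDecay_proof @ f67e8ca18595 (prover) · by planner
why it might fail: Vacuous iff θ(p_c)=0 (irrefutable). Jump world: ergodicity gives only e_m → 0; FKG bounds P(1..m ∉ C_∞) below by (1−θ)^m, so a power rate needs same-p decorrelation along a line, known only via sprinkling (GM1990, p > p_c; its removal 'presently open', arXiv:2308.07920 p.4); 1/r² chains jump at p_c.
sources: KozmaNitzan2024, GrimmettMarstrand1990, Grimmett1999, BarskyGrimmettNewman1991, arXiv:2308.07920, doi:10.1007/bf01218582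
[crux] G — in the jump world the axis is visited with a power-law rate: θ(p_c) > 0 ⇒ ∃ κ > 0, C:
P_{p_c}(∀ 1 ≤ i ≤ m, |C(i e₀)| < ∞) ≤ C m^{−κ} for all m ≥ 1 (card item G1/G1e in its weakest useful
form: ANY κ > 0 suffices for the renewal count; e_m → 0 itself is free by ergodicity). [difficulty:
XL] -/
@[route_item "route-CriticalPhenomena-PercRayRenewal"]
def JumpLineAvoidanceDecay : Prop :=
  0 < Literature.Probability.Percolation.theta (Literature.Probability.LatticeModels.zdGraph 3) 0 (Literature.Probability.Percolation.criticalProbI 3) → ∃ κ C : ℝ, 0 < κ ∧ ∀ m : ℕ, 1 ≤ m → (Literature.Probability.Percolation.bondPercolation (Literature.Probability.LatticeModels.zdGraph 3) (Literature.Probability.Percolation.criticalProbI 3)).real {ω | ∀ i : ℕ, 1 ≤ i → i ≤ m → ω ∉ Literature.Probability.Percolation.percolatesAt (Pi.single 0 (i : ℤ) : Literature.Probability.LatticeModels.Site 3)} ≤ C * (m : ℝ) ^ (-κ)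

/-- item stmt-CriticalPhenomena-4627 · crux · rank 4 · open · by planner
why it might fail: Vacuous iff θ(p_c)=0. A finite-cluster radius tail from θ(p)>0 alone is Cerf's 'missing ingredient' (Cerf2015 p.4; Thm 1.3 reaches only Λ(n^16)); σ(p)>0 known only for p>p_c via slabs (Grimmett1999 Thm 8.21, GM1990), unusable at p_c as θ_{S_k}(p_c)=0 for all k (DST2016); fat finite clusters remain.
sources: Grimmett1999, Cerf2015, ChayesChayesNewman1987, GrimmettMarstrand1990, DuminilCopinSidoraviciusTassion2016, arXiv:2308.07920
[crux] G1′ — in the jump world finite clusters have a power-law radius tail: θ(p_c) > 0 ⇒ ∃ a > 0,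
C: P_{p_c}(0 ↔ ∂Λ(n) in Λ(n), |C(0)| < ∞) ≤ C n^{−a} for all n ≥ 1 (card item G1′ with the demand
lowered from a > 4 to any a > 0; the p > p_c analogue is Grimmett1999 Thm (8.21), σ(p) > 0, with
exponential decay). Implies JumpLineAvoidanceDecay by the box chain (support BoxChainLineAvoidance);
implied by PercTruncatedSusceptibility.FiniteRadiusExpDecayOfTheta and by its L (χ^f < ∞ gives a =
1). [difficulty: XL] -/
@[route_item "route-CriticalPhenomena-PercRayRenewal"]
def JumpTruncatedOneArmDecay : Prop :=
  0 < Literature.Probability.Percolation.theta (Literature.Probability.LatticeModels.zdGraph 3) 0 (Literature.Probability.Percolation.criticalProbI 3) → ∃ a C : ℝ, 0 < a ∧ ∀ n : ℕ, 1 ≤ n → (Literature.Probability.Percolation.bondPercolation (Literature.Probability.LatticeModels.zdGraph 3) (Literature.Probability.Percolation.criticalProbI 3)).real (Literature.Probability.Percolation.siteToBoundary 3 n \ Literature.Probability.Percolation.percolatesAt 0) ≤ C * (n : ℝ) ^ (-a)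

/-- item stmt-CriticalPhenomena-4628 · support · rank 9 · closed · proved by Summit.CriticalPhenomena.PercolationContinuityZ3.Theorems.boxChainLineAvoidance_proof @ 1017ed020ea4 (prover) · by planner
sources: Grimmett1999, Literature.Probability.Percolation.bondPercolation_inter_of_disjoint
[support] JumpTruncatedOneArmDecay → JumpLineAvoidanceDecay. Proof (provable now, ≈ 1 page): place K
= ⌊m/(2n+2)⌋ disjoint boxes Λ(n)+x_j centred at axis sites x_j ∈ {e₀,…,m e₀}; x_j ∉ C_∞ ⇒ C(x_j)
finite ⇒ either the truncated one-arm event of radius n at x_j (probability π^f_n each, union bound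
K π^f_n) or x_j ↮ ∂(Λ(n)+x_j) inside its box — events determined by disjoint edge sets, hence
independent (bondPercolation_inter_of_disjoint), each of probability 1 − P(0 ↔ ∂Λ(n)) ≤ 1 − θ(p_c);
so e_m ≤ K C n^{−a} + (1 − θ*)^K, and n = m^λ with λ ∈ (1/(1+a), 1) gives e_m ≤ C′ m^{−(λ(1+a)−1)}.
[difficulty: provable-now] -/
@[route_item "route-CriticalPhenomena-PercRayRenewal"]
def BoxChainLineAvoidance : Prop :=
  (0 < Literature.Probability.Percolation.theta (Literature.Probability.LatticeModels.zdGraph 3) 0 (Literature.Probability.Percolation.criticalProbI 3) → ∃ a C : ℝ, 0 < a ∧ ∀ n : ℕ, 1 ≤ n → (Literature.Probability.Percolation.bondPercolation (Literature.Probability.LatticeModels.zdGraph 3) (Literature.Probability.Percolation.criticalProbI 3)).real (Literature.Probability.Percolation.siteToBoundary 3 n \ Literature.Probability.Percolation.percolatesAt 0) ≤ C * (n : ℝ) ^ (-a)) → (0 < Literature.Probability.Percolation.theta (Literature.Probability.LatticeModels.zdGraph 3) 0 (Literature.Probability.Percolation.criticalProbI 3) → ∃ κ C : ℝ, 0 <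 κ ∧ ∀ m : ℕ, 1 ≤ m → (Literature.Probability.Percolation.bondPercolation (Literature.Probability.LatticeModels.zdGraph 3) (Literature.Probability.Percolation.criticalProbI 3)).real {ω | ∀ i : ℕ, 1 ≤ i → i ≤ m → ω ∉ Literature.Probability.Percolation.percolatesAt (Pi.single 0 (i : ℤ) : Literature.Probability.LatticeModels.Site 3)} ≤ C * (m : ℝ) ^ (-κ))

/-- item stmt-CriticalPhenomena-4629 · support · rank 9 · closed · proved by Summit.CriticalPhenomena.PercolationContinuityZ3.Theorems.halfSpacePiecesFinite_proof (prover) · by planner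
sources: BarskyGrimmettNewman1991, Grimmett1999, Literature.Probability.Percolation.BarskyGrimmettNewman1991_Z3_holds
[support] BGN at every depth, bulk form: for every t ≥ 0, P_{p_c}-a.s. the set of sites joined to t
e₀ by open paths staying in H = {x₀ ≥ 0} is finite. Proof (provable now): for t = 0 this is
BarskyGrimmettNewman1991_Z3_holds transported through the restriction-to-H coupling
(HalfSpaceBGN.lean); for t > 0 force open the t axis edges from 0 to t e₀ (finite energy,
bondPercolation_finiteEnergy / harris_fkg_holds, p_c > 0): P(piece of t e₀ infinite) ≤ p_c^{−t}
P(piece of 0 infinite) = 0. [difficulty: provable-now] -/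
@[route_item "route-CriticalPhenomena-PercRayRenewal"]
def HalfSpacePiecesFinite : Prop :=
  ∀ t : ℕ, (Literature.Probability.Percolation.bondPercolation (Literature.Probability.LatticeModels.zdGraph 3) (Literature.Probability.Percolation.criticalProbI 3)).real {ω | {y : Literature.Probability.LatticeModels.Site 3 | ω ∈ Literature.Probability.Percolation.openConnIn {x : Literature.Probability.LatticeModels.Site 3 | 0 ≤ x 0} (Pi.single 0 (t : ℤ) : Literature.Probability.LatticeModels.Site 3) y}.Infinite} = 0

/-- item stmt-CriticalPhenomena-4630 · assembly · rank 1 · closed · proved by Summit.CriticalPhenomena.PercolationContinuityZ3.Theorems.percRayRenewalAssembly_proof @ 73e5626f030a (prover) · by planner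
sources: BarskyGrimmettNewman1991, KozmaNitzan2024, Grimmett1999, LyonsPeres2016
[assembly] TwoArmsRatioExponent → JumpLineAvoidanceDecay → PercolationContinuityZ3 (ray-renewal
criterion: BGN shattering + stationarity along e₀ + block union bound + Borel–Cantelli, as above;
JumpTruncatedOneArmDecay enters only through the support BoxChainLineAvoidance as a sufficient
condition for the second antecedent). -/
@[route_item "route-CriticalPhenomena-PercRayRenewal"]
def Assembly : Prop :=
  TwoArmsRatioExponent → JumpLineAvoidanceDecay → PercolationContinuityZ3

/-! D-0027 §2.1 — DECIDING THEOREM (planner-authored via `route open/edit --closes-file`; by planner-rbadge-CriticalPhenomena-PercRayRenewa-31c20d48-g4-0 2026-08-15T16:11:10Z):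
its hypotheses are this route's items and its conclusion the sub-problem Statement (glue_lint), and it elaborates with this file. -/

@[closes "route-CriticalPhenomena-PercRayRenewal"] theorem closes : TwoArmsRatioExponent → JumpLineAvoidanceDecay → Assembly → _root_.PercolationContinuityZ3 :=
  fun h_TwoArmsRatioExponent h_JumpLineAvoidanceDecay h_Assembly =>
    h_Assembly h_TwoArmsRatioExponent h_JumpLineAvoidanceDecay

end Summit.CriticalPhenomena.PercolationContinuityZ3.Theses.PercRayRenewal
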